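import Literature.RingTheory.CohomologyAnnihilator.BirationalTransfer
import Literature.RingTheory.CohomologyAnnihilator.StrongGenerator
import HarnessLib

/-!
# Birational persistence of the cohomology annihilator from syzygy descent

Topic: `Literature/RingTheory/CohomologyAnnihilator`.

Folklore homological algebra packaging the sibling files `StableAnnihilation` (splitting
criterion, injective dimension shifting), `StrongGenerator` (the syzygy predicate
`IsSyzygy s M K`, "`K` is an `s`-th syzygy module `Ωˢ M` of `M`", with dimension shifting along it
in both directions and `exists_isSyzygy`) and `BirationalTransfer` (the birational
stable-annihilation transfer `smul_ext_eq_zero_of_isBirational`) into a criterion for the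
**persistence of cohomology annihilators along a birational ring map `B → C`**
(`[Algebra B C]`, `C` torsion-free over `B`, every `s : C` having `b · s = r · 1` for some
non-zero-divisor `b ∈ B⁰` and some `r : B` — e.g. `B ⊆ C ⊆ Frac B`).

1. **Stable factorisation on a high syzygy** (`exists_comp_eq_smul_id_of_isSyzygy`): if
   `c ∈ caᵗ⁺¹(B)` and `Y₀` is a `(t+1)`-th syzygy of a finitely generated `B`-module `X`
   (`IsSyzygy (t + 1) X Y₀`, `B` noetherian), then the homothety `c • 𝟙 Y₀` factors through a
   finitely generated projective: `ι ≫ π = c • 𝟙 Y₀` with `ι : Y₀ ⟶ P`, `π : P ⟶ Y₀` (indeed the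
   defining sequence `0 → Y₀ → P → Ωᵗ X → 0` has `c • Ext¹(Ωᵗ X, Y₀) ↪ c • Extᵗ⁺¹(X, Y₀) = 0`, so
   the splitting criterion applies). Hence `c` kills `Extⁱ_B(Y₀, N)` for ALL `N` and `i ≥ 1`
   (`smul_ext_eq_zero_of_isSyzygy_succ`) and, by the birational transfer, `algebraMap B C c`
   kills `Extⁱ_C(Y, N)` for every `C`-module `Y = C · φ(Y₀)` generated by an injective `B`-linear
   image of `Y₀` (`smul_ext_eq_zero_of_isSyzygy_of_isBirational`).
2. **Descent hypothesis ⇒ persistence**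
   (`algebraMap_mem_cohomologyAnnihilatorOfDegree_succ_of_descent`): let `C` be noetherian and
   suppose that every `e`-th syzygy `K` of every finitely generated `C`-module `M` is generated
   over `C` by the injective image `φ(Y₀)` of a `B`-module `Y₀` on which `c • 𝟙` factors through a
   projective `B`-module. Then `algebraMap B C c ∈ caᵉ⁺¹(C)`: `Ext^{≥ e+1}_C(M, N)` is reached from
   `Ext^{≥ 1}_C(K, N)` by surjective dimension shifting (`mem_extAnnihilatorFrom_of_isSyzygy`),
   and the latter is killed by `algebraMap B C c` (birational transfer).
3. **Syzygy-descent form**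
   (`algebraMap_mem_cohomologyAnnihilatorOfDegree_succ_of_syzygyDescent`,
   `algebraMap_mem_cohomologyAnnihilator_of_syzygyDescent`): if every `e`-th `C`-syzygy `K` of a
   finitely generated `C`-module is `C · φ(Y₀)` for an injective `B`-linear `φ : Y₀ → K` with `Y₀`
   a `(t+1)`-th `B`-syzygy of a finitely generated `B`-module ("syzygy descent"), then
   `c ∈ caᵗ⁺¹(B)` implies `algebraMap B C c ∈ caᵉ⁺¹(C)` (1 + 2), and `c ∈ ca(B)` implies
   `algebraMap B C c ∈ ca(C)` when such descent data exist for the relevant `t`.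
   `Subalgebra.algebraMap_mem_cohomologyAnnihilatorOfDegree_succ_of_syzygyDescent` is the case of
   two subalgebras `B`, `C` of a field `K` with `C ⊆ Frac B` inside `K`.

Conventions (as in `BirationalTransfer`, `Basic`): `B C : Type u`, modules in `ModuleCat.{u}`,
`Ext = CategoryTheory.Abelian.Ext.{u}`. In the descent hypotheses the `C`-module `K` (an object
of `ModuleCat C` produced by `IsSyzygy`) carries an ARBITRARY `B`-module structure compatible
with `algebraMap B C` — instance binders `[Module B K] [IsScalarTower B C K]`, exactly the
instance path of `smul_ext_eq_zero_of_isBirational` — and the proofs instantiate it with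
`Module.compHom K (algebraMap B C)`. The birationality hypothesis `hbir` comes last (pass
`(B := B) (C := C)` if unification of coerced subalgebras is slow). No finiteness is imposed on the
descent data `Y₀`, `P₀` beyond what `IsSyzygy` carries.
-/

noncomputable section

open CategoryTheory CategoryTheory.Abelian

open scoped nonZeroDivisors

universe u

namespace Literature.RingTheory.CohomologyAnnihilator

/-! ## (1) Stable factorisation on a high syzygy -/

section Syzygy

variable {B : Type u} [CommRing B]

/-- Syzygy modules of finitely generated modules over a noetherian ring are finitely generated:
if `IsSyzygy s X K` with `X` finitely generated (`s = 0`: `K ≅ X`) or `s ≥ 1` (`K ↪ P` with `P`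
finitely generated, `B` noetherian), then `K` is finitely generated. [folklore] -/
theorem finite_of_isSyzygy [IsNoetherianRing B] :
    ∀ (s : ℕ) {X K : ModuleCat.{u} B}, Module.Finite B X → IsSyzygy s X K → Module.Finite B K
  | 0, _, _, hX, ⟨e⟩ => by
    haveI := hX
    exact Module.Finite.equiv e.symm.toLinearEquiv
  | _ + 1, _, _, _, ⟨_, _, _, hP, _, f, _, _, hS⟩ => by
    haveI := hP
    exact Module.Finite.of_injective f.hom ((ModuleCat.mono_iff_injective f).mp hS.mono_f)

/-- **Stable factorisation on a high syzygy (finitely generated form).** Let `c ∈ caᵗ⁺¹(B)` and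
let `Y₀` be a `(t+1)`-th syzygy of `X` (`IsSyzygy (t + 1) X Y₀`) with `X` and `Y₀` finitely
generated. Then `c • 𝟙 Y₀` factors through a finitely generated projective `B`-module: there are
`ι : Y₀ ⟶ P`, `π : P ⟶ Y₀` with `ι ≫ π = c • 𝟙 Y₀` (namely `ι` the first map of the defining
sequence `0 → Y₀ → P → K' → 0`, `K'` a `t`-th syzygy of `X`). Proof: `c` kills
`Extᵗ⁺¹(X, Y₀)`, hence `Ext¹(K', Y₀)` (injective dimension shifting `ext_smul_eq_zero_of_isSyzygy`),
and the splitting criterion `exists_comp_eq_smul_id_of_forall_smul_ext_one_eq_zero` applies.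
[folklore] -/
theorem exists_comp_eq_smul_id_of_isSyzygy_of_finite {t : ℕ} {c : B}
    (hc : c ∈ cohomologyAnnihilatorOfDegree B (t + 1)) {X Y₀ : ModuleCat.{u} B}
    [Module.Finite B X] [Module.Finite B Y₀] (hY : IsSyzygy (t + 1) X Y₀) :
    ∃ (P : ModuleCat.{u} B) (_ : Module.Finite B P) (_ : Projective P) (ι : Y₀ ⟶ P)
      (π : P ⟶ Y₀), ι ≫ π = c • 𝟙 Y₀ := by
  obtain ⟨K', P, hK', hPfin, hP, f, g, w, hS⟩ := hY
  haveI : Projective (ShortComplex.mk f g w).X₂ := hP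
  obtain ⟨π, hπ⟩ := exists_comp_eq_smul_id_of_forall_smul_ext_one_eq_zero hS (c := c) fun x =>
    ext_smul_eq_zero_of_isSyzygy t hK' Y₀ 1 le_rfl c
      (fun e' => smul_eq_zero_of_mem_cohomologyAnnihilatorOfDegree hc (by omega) e') x
  exact ⟨P, hPfin, hP, f, π, hπ⟩

/-- **Stable factorisation on a high syzygy.** Over a noetherian ring `B`, let `c ∈ caᵗ⁺¹(B)`
and let `Y₀` be a `(t+1)`-th syzygy of a finitely generated module `X` (`IsSyzygy (t + 1) X Y₀`).
Then `c • 𝟙 Y₀` factors through a finitely generated projective `B`-module: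
`ι ≫ π = c • 𝟙 Y₀` for some `ι : Y₀ ⟶ P`, `π : P ⟶ Y₀`
(`exists_comp_eq_smul_id_of_isSyzygy_of_finite`; `Y₀` is finitely generated by
`finite_of_isSyzygy`). [folklore] -/
theorem exists_comp_eq_smul_id_of_isSyzygy [IsNoetherianRing B] {t : ℕ} {c : B}
    (hc : c ∈ cohomologyAnnihilatorOfDegree B (t + 1)) {X Y₀ : ModuleCat.{u} B}
    [Module.Finite B X] (hY : IsSyzygy (t + 1) X Y₀) :
    ∃ (P : ModuleCat.{u} B) (_ : Module.Finite B P) (_ : Projective P) (ι : Y₀ ⟶ P)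
      (π : P ⟶ Y₀), ι ≫ π = c • 𝟙 Y₀ :=
  haveI := finite_of_isSyzygy (t + 1) ‹_› hY
  exists_comp_eq_smul_id_of_isSyzygy_of_finite hc hY

/-- **`caᵗ⁺¹(B)` stably annihilates `(t+1)`-th syzygies.** Over a noetherian ring `B`, if
`c ∈ caᵗ⁺¹(B)` and `Y₀` is a `(t+1)`-th syzygy of a finitely generated module `X`, then `c` kills
`Extⁱ_B(Y₀, N)` for EVERY `B`-module `N` (finitely generated or not) and every `i ≥ 1`
(`exists_comp_eq_smul_id_of_isSyzygy` + `smul_ext_eq_zero_of_comp_eq_smul_id`). [folklore] -/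
theorem smul_ext_eq_zero_of_isSyzygy_succ [IsNoetherianRing B] {t : ℕ} {c : B}
    (hc : c ∈ cohomologyAnnihilatorOfDegree B (t + 1)) {X Y₀ : ModuleCat.{u} B}
    [Module.Finite B X] (hY : IsSyzygy (t + 1) X Y₀) (N : ModuleCat.{u} B) {i : ℕ} (hi : 1 ≤ i)
    (e : Ext.{u} Y₀ N i) : c • e = 0 := by
  obtain ⟨P, _, hP, ι, π, h⟩ := exists_comp_eq_smul_id_of_isSyzygy hc hY
  haveI := hP
  exact smul_ext_eq_zero_of_comp_eq_smul_id ι π h hi e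

end Syzygy

/-! ## (2) Birational transfer of the stable factorisation; descent ⇒ persistence -/

section Persistence

variable {B C : Type u} [CommRing B] [CommRing C] [Algebra B C]

/-- **Birational stable-annihilation transfer, `ModuleCat` form.** Let `B → C` be birational
(every `s : C` has `b · s = r · 1` with `b ∈ B⁰`, `r : B`) with `C` torsion-free over `B`, let
`ι₀ ≫ π₀ = c • 𝟙 Y₀` in `ModuleCat B` with `P₀` projective, and let the `C`-module `K` (an object of
`ModuleCat C` with a compatible `B`-module structure) be generated over `C` by the image of an
injective `B`-linear map `φ : Y₀ → K`. Then `algebraMap B C c` kills `Extⁱ_C(K, N)` for every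
`C`-module `N` and every `i ≥ 1` (`smul_ext_eq_zero_of_isBirational` of `BirationalTransfer`,
restated for objects and morphisms of `ModuleCat`). [folklore] -/
theorem smul_ext_eq_zero_of_isBirational' [Module.IsTorsionFree B C] {c : B}
    {Y₀ P₀ : ModuleCat.{u} B} [Projective P₀] (ι₀ : Y₀ ⟶ P₀) (π₀ : P₀ ⟶ Y₀)
    (h : ι₀ ≫ π₀ = c • 𝟙 Y₀)
    (hbir : ∀ s : C, ∃ b : B, b ∈ B⁰ ∧ ∃ r : B, algebraMap B C b * s = algebraMap B C r)
    {K : ModuleCat.{u} C} [Module B K] [IsScalarTower B C K] (φ : Y₀ →ₗ[B] K)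
    (hφ : Function.Injective φ) (hspan : Submodule.span C (Set.range φ) = ⊤)
    (N : ModuleCat.{u} C) {i : ℕ} (hi : 1 ≤ i) (e : Ext.{u} K N i) :
    algebraMap B C c • e = 0 :=
  smul_ext_eq_zero_of_isBirational (B := B) (C := C) (Y := K) ι₀.hom π₀.hom
    ((ModuleCat.comp_eq_smul_id_iff ι₀ π₀ c).mp h) hbir φ hφ hspan N hi e

/-- **High `B`-syzygies generate `C`-modules stably annihilated by `caᵗ⁺¹(B)`.** Let `B → C` be
birational with `C` torsion-free over `B` and `B` noetherian, `c ∈ caᵗ⁺¹(B)`, `Y₀` a `(t+1)`-th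
syzygy of a finitely generated `B`-module `X`, and `K` a `C`-module generated over `C` by the
image of an injective `B`-linear map `φ : Y₀ → K`. Then `algebraMap B C c` kills `Extⁱ_C(K, N)`
for every `C`-module `N` and every `i ≥ 1` (`exists_comp_eq_smul_id_of_isSyzygy` +
`smul_ext_eq_zero_of_isBirational'`). [folklore] -/
theorem smul_ext_eq_zero_of_isSyzygy_of_isBirational [IsNoetherianRing B]
    [Module.IsTorsionFree B C] {t : ℕ} {c : B} (hc : c ∈ cohomologyAnnihilatorOfDegree B (t + 1))
    {X Y₀ : ModuleCat.{u} B} [Module.Finite B X] (hY : IsSyzygy (t + 1) X Y₀)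
    (hbir : ∀ s : C, ∃ b : B, b ∈ B⁰ ∧ ∃ r : B, algebraMap B C b * s = algebraMap B C r)
    {K : ModuleCat.{u} C} [Module B K] [IsScalarTower B C K] (φ : Y₀ →ₗ[B] K)
    (hφ : Function.Injective φ) (hspan : Submodule.span C (Set.range φ) = ⊤)
    (N : ModuleCat.{u} C) {i : ℕ} (hi : 1 ≤ i) (e : Ext.{u} K N i) :
    algebraMap B C c • e = 0 := by
  obtain ⟨P, _, hP, ι, π, h⟩ := exists_comp_eq_smul_id_of_isSyzygy hc hY
  haveI := hP
  exact smul_ext_eq_zero_of_isBirational' ι π h hbir φ hφ hspan N hi e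

/-- **Descent hypothesis ⇒ persistence.** Let `B → C` be birational (every `s : C` has
`b · s = r · 1` with `b ∈ B⁰`, `r : B`) with `C` noetherian and torsion-free over `B`, and let
`c : B`, `e : ℕ`. Suppose (`hSD`) that for every finitely generated `C`-module `M` and every
(finitely generated) `e`-th syzygy `K` of `M` — equipped with any `B`-module structure compatible
with `algebraMap B C` — there are a `B`-module `Y₀` on which `c • 𝟙` factors through a projective
`B`-module (`ι₀ ≫ π₀ = c • 𝟙 Y₀`) and an injective `B`-linear map `φ : Y₀ → K` whose image generates
`K` over `C`. Then `algebraMap B C c ∈ caᵉ⁺¹(C)`. Proof: for `M`, `N` finitely generated pick an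
`e`-th syzygy `K` of `M` (`exists_isSyzygy`); `algebraMap B C c` kills `Ext^{≥ 1}_C(K, −)`
(`smul_ext_eq_zero_of_isBirational'`), hence `Ext^{≥ e+1}_C(M, −)` on finitely generated modules
(surjective dimension shifting, `mem_extAnnihilatorFrom_of_isSyzygy`). [folklore] -/
theorem algebraMap_mem_cohomologyAnnihilatorOfDegree_succ_of_descent [IsNoetherianRing C]
    [Module.IsTorsionFree B C] {c : B} {e : ℕ}
    (hSD : ∀ (M K : ModuleCat.{u} C) [Module B K] [IsScalarTower B C K],
      Module.Finite C M → Module.Finite C K → IsSyzygy e M K →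
        ∃ (Y₀ P₀ : ModuleCat.{u} B) (_ : Projective P₀) (ι₀ : Y₀ ⟶ P₀) (π₀ : P₀ ⟶ Y₀)
          (φ : Y₀ →ₗ[B] K), ι₀ ≫ π₀ = c • 𝟙 Y₀ ∧ Function.Injective φ ∧
            Submodule.span C (Set.range φ) = ⊤)
    (hbir : ∀ s : C, ∃ b : B, b ∈ B⁰ ∧ ∃ r : B, algebraMap B C b * s = algebraMap B C r) :
    algebraMap B C c ∈ cohomologyAnnihilatorOfDegree C (e + 1) := by
  rw [mem_cohomologyAnnihilatorOfDegree_iff_forall_mem_extAnnihilatorFrom]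
  intro M hM
  haveI := hM
  obtain ⟨K, hKfin, hK⟩ := exists_isSyzygy M e
  have h1 : algebraMap B C c ∈ extAnnihilatorFrom K 1 := by
    letI : Module B K := Module.compHom K (algebraMap B C)
    haveI : IsScalarTower B C K := IsScalarTower.of_algebraMap_smul fun _ _ => rfl
    obtain ⟨Y₀, P₀, hP₀, ι₀, π₀, φ, h, hφ, hspan⟩ := hSD M K hM hKfin hK
    haveI := hP₀
    rw [mem_extAnnihilatorFrom_iff]
    intro i hi N _ x
    exact smul_ext_eq_zero_of_isBirational' ι₀ π₀ h hbir φ hφ hspan N hi x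
  have h2 := mem_extAnnihilatorFrom_of_isSyzygy e hK h1
  rwa [Nat.add_comm] at h2

/-! ## (3) Syzygy descent ⇒ persistence -/

/-- **Syzygy descent ⇒ persistence of `caᵗ⁺¹`.** Let `B → C` be birational (every `s : C` has
`b · s = r · 1` with `b ∈ B⁰`, `r : B`) with `B`, `C` noetherian and `C` torsion-free over `B`, and
let `c ∈ caᵗ⁺¹(B)`. Suppose (`hSD`, "syzygy descent") that every (finitely generated) `e`-th
syzygy `K` of every finitely generated `C`-module `M` — with any `B`-module structure compatible
with `algebraMap B C` — is generated over `C` by the image of an injective `B`-linear map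
`φ : Y₀ → K` from a `(t+1)`-th syzygy `Y₀` of some finitely generated `B`-module `X`. Then
`algebraMap B C c ∈ caᵉ⁺¹(C)` (`exists_comp_eq_smul_id_of_isSyzygy` feeds
`algebraMap_mem_cohomologyAnnihilatorOfDegree_succ_of_descent`). [folklore] -/
theorem algebraMap_mem_cohomologyAnnihilatorOfDegree_succ_of_syzygyDescent [IsNoetherianRing B]
    [IsNoetherianRing C] [Module.IsTorsionFree B C] {c : B} {t e : ℕ}
    (hc : c ∈ cohomologyAnnihilatorOfDegree B (t + 1))
    (hSD : ∀ (M K : ModuleCat.{u} C) [Module B K] [IsScalarTower B C K],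
      Module.Finite C M → Module.Finite C K → IsSyzygy e M K →
        ∃ (X Y₀ : ModuleCat.{u} B) (φ : Y₀ →ₗ[B] K), Module.Finite B X ∧
          IsSyzygy (t + 1) X Y₀ ∧ Function.Injective φ ∧ Submodule.span C (Set.range φ) = ⊤)
    (hbir : ∀ s : C, ∃ b : B, b ∈ B⁰ ∧ ∃ r : B, algebraMap B C b * s = algebraMap B C r) :
    algebraMap B C c ∈ cohomologyAnnihilatorOfDegree C (e + 1) := by
  refine algebraMap_mem_cohomologyAnnihilatorOfDegree_succ_of_descent
    (fun M K _ _ hM hK hKs => ?_) hbir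
  obtain ⟨X, Y₀, φ, hX, hY, hφ, hspan⟩ := hSD M K hM hK hKs
  haveI := hX
  obtain ⟨P, _, hP, ι, π, h⟩ := exists_comp_eq_smul_id_of_isSyzygy hc hY
  exact ⟨Y₀, P, hP, ι, π, φ, h, hφ, hspan⟩

/-- **Syzygy descent ⇒ persistence of the cohomology annihilator.** Let `B → C` be birational
with `B`, `C` noetherian and `C` torsion-free over `B`, and let `c ∈ ca(B)`. Suppose that for
every `t` with `c ∈ caᵗ⁺¹(B)` there is an `e` such that every `e`-th `C`-syzygy of a finitely
generated `C`-module is generated over `C` by an injective `B`-linear image of a `(t+1)`-th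
`B`-syzygy of a finitely generated `B`-module (syzygy descent in some degree). Then
`algebraMap B C c ∈ ca(C)` (as `ca(B) = ⋃ₜ caᵗ⁺¹(B)` and `caᵉ⁺¹(C) ⊆ ca(C)`). [folklore] -/
theorem algebraMap_mem_cohomologyAnnihilator_of_syzygyDescent [IsNoetherianRing B]
    [IsNoetherianRing C] [Module.IsTorsionFree B C] {c : B} (hc : c ∈ cohomologyAnnihilator B)
    (hSD : ∀ t : ℕ, c ∈ cohomologyAnnihilatorOfDegree B (t + 1) → ∃ e : ℕ,
      ∀ (M K : ModuleCat.{u} C) [Module B K] [IsScalarTower B C K],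
        Module.Finite C M → Module.Finite C K → IsSyzygy e M K →
          ∃ (X Y₀ : ModuleCat.{u} B) (φ : Y₀ →ₗ[B] K), Module.Finite B X ∧
            IsSyzygy (t + 1) X Y₀ ∧ Function.Injective φ ∧ Submodule.span C (Set.range φ) = ⊤)
    (hbir : ∀ s : C, ∃ b : B, b ∈ B⁰ ∧ ∃ r : B, algebraMap B C b * s = algebraMap B C r) :
    algebraMap B C c ∈ cohomologyAnnihilator C := by
  obtain ⟨n, hn⟩ := mem_cohomologyAnnihilator_iff.mp hc
  have hn' : c ∈ cohomologyAnnihilatorOfDegree B (n + 1) :=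
    cohomologyAnnihilatorOfDegree_mono (Nat.le_succ n) hn
  obtain ⟨e, he⟩ := hSD n hn'
  exact cohomologyAnnihilatorOfDegree_le (e + 1)
    (algebraMap_mem_cohomologyAnnihilatorOfDegree_succ_of_syzygyDescent hn' he hbir)

end Persistence

/-! ### Subalgebras `B`, `C` of a field with `C ⊆ Frac B` -/

section Subalgebra

open Literature.RingTheory.Localization

variable {k : Type u} {K : Type u} [CommRing k] [Field K] [Algebra k K] {B C : Subalgebra k K}

/-- **Syzygy descent ⇒ persistence, for subalgebras of a field.** Let `B`, `C` be subalgebras of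
a field `K` (over a base ring `k`) with an algebra structure `↥B → ↥C` compatible with the
inclusions into `K` (e.g. the inclusion of `B ≤ C`:
`letI := (Subalgebra.inclusion h).toRingHom.toAlgebra`, `Subalgebra.isScalarTower_inclusion`),
both noetherian, with `C ⊆ Frac B` inside `K` (`∀ s ∈ C, ∃ b ∈ B, b ≠ 0 ∧ b * s ∈ B`). If
`c ∈ caᵗ⁺¹(B)` and every `e`-th `↥C`-syzygy of a finitely generated `↥C`-module is generated over
`↥C` by an injective `↥B`-linear image of a `(t+1)`-th `↥B`-syzygy of a finitely generated
`↥B`-module, then `algebraMap B C c ∈ caᵉ⁺¹(C)`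
(`algebraMap_mem_cohomologyAnnihilatorOfDegree_succ_of_syzygyDescent`; `↥C` is torsion-free over
`↥B` by `Subalgebra.isTorsionFree_of_isScalarTower`, birational by
`Subalgebra.exists_mem_nonZeroDivisors_mul_eq`). [folklore] -/
theorem Subalgebra.algebraMap_mem_cohomologyAnnihilatorOfDegree_succ_of_syzygyDescent
    [Algebra B C] [IsScalarTower B C K] [IsNoetherianRing B] [IsNoetherianRing C]
    (hfrac : ∀ s ∈ C, ∃ b ∈ B, b ≠ 0 ∧ b * s ∈ B) {c : B} {t e : ℕ}
    (hc : c ∈ cohomologyAnnihilatorOfDegree B (t + 1))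
    (hSD : ∀ (M N : ModuleCat.{u} C) [Module B N] [IsScalarTower B C N],
      Module.Finite C M → Module.Finite C N → IsSyzygy e M N →
        ∃ (X Y₀ : ModuleCat.{u} B) (φ : Y₀ →ₗ[B] N), Module.Finite B X ∧
          IsSyzygy (t + 1) X Y₀ ∧ Function.Injective φ ∧ Submodule.span C (Set.range φ) = ⊤) :
    algebraMap B C c ∈ cohomologyAnnihilatorOfDegree C (e + 1) :=
  haveI : Module.IsTorsionFree B C := Subalgebra.isTorsionFree_of_isScalarTower
  CohomologyAnnihilator.algebraMap_mem_cohomologyAnnihilatorOfDegree_succ_of_syzygyDescent hc hSD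
    (Subalgebra.exists_mem_nonZeroDivisors_mul_eq hfrac)

end Subalgebra

end Literature.RingTheory.CohomologyAnnihilator
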